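import Summits.MatrixMultiplication.MatrixMultiplication.Theorems.AbelianSTPPCensusTCStatDefs

/-!
# T_C static certificate, orders `628 … 2880` (theory's t*-indexed linear checker at `τ = 12/5`): kernel evaluation, the domination checks, volumes `1704 … 2235`

Cell mm-stpp (rung F-M1), tier T_C = «beat `2.4`»; checker in `AbelianSTPPCensusTCStatDefs.lean`, table in `AbelianSTPPCensusTCStatData.lean`
(pattern: theory g12's `AbelianSTPPCensusTAStatCDom*.lean`).  `decide` with kernel reduction (standard axioms; no `native_decide`), `Elab.async false`;
consumed by `TCStat.checkV_sound` / `TCStat.domV_sound` in the leaf `AbelianSTPPCensusLeafTC2880Closed.lean`.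
the domination checks, volumes `1704 … 2235` THIS IS NOT: arithmetic on shape lists only; no statement about STPP families or `ω`.
-/

set_option linter.dupNamespace false
set_option autoImplicit false
set_option Elab.async false

namespace Summit.MatrixMultiplication.MatrixMultiplication.Theorems.TCStat

set_option maxHeartbeats 0 in
/-- Domination chunk: every sorted candidate shape of the volumes `1704 … 1835` is dominated by the table (890 shapes). [original] -/
theorem dom1704 : TCStat.domV 132 1704 = true := by decide +kernel

set_option maxHeartbeats 0 in
/-- Domination chunk: every sorted candidate shape of the volumes `1836 … 1967` is dominated by the table (894 shapes). [original] -/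
theorem dom1836 : TCStat.domV 132 1836 = true := by decide +kernel

set_option maxHeartbeats 0 in
/-- Domination chunk: every sorted candidate shape of the volumes `1968 … 2099` is dominated by the table (850 shapes). [original] -/
theorem dom1968 : TCStat.domV 132 1968 = true := by decide +kernel

set_option maxHeartbeats 0 in
/-- Domination chunk: every sorted candidate shape of the volumes `2100 … 2235` is dominated by the table (899 shapes). [original] -/
theorem dom2100 : TCStat.domV 136 2100 = true := by decide +kernel

end Summit.MatrixMultiplication.MatrixMultiplication.Theorems.TCStat
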